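import Summits.KontsevichZagierPeriods.KontsevichZagierPeriods.Theorems.LinRedNormalFormAssembly
import Literature.NumberTheory.Transcendental.KZKernelConjectureForms

/-!
# Crux `HoffmanIndependence` (stmt-KontsevichZagierPeriods-15045) — the SECTOR SPLIT
# (crux-strategist redirect r1, 2026-08-17): kernel on the Hoffman subgroup × formal independence

The crux `Theses.LinRedNormalForm.HoffmanIndependence` (`ℚ`-linear independence of ALL real Hoffman
values `ζ(u)`, `u ∈ {2,3}^×`; = Zagier's conjecture given crux #6, `…RealSpanning.lean`) is the
hypothesis `hIND` of the route's deciding theorem `closes`.  This file shows that for the route it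
over-shoots, and by exactly how much.  Two statements over the calculus of `KZCalculus.lean`, written
out IN FULL in every signature (local notations `HKer`, `HFormInd` below; no new declarations, so that
a planner can file either text verbatim as a route item):
* **HK** (`HKer`) — the KZ KERNEL CONJECTURE ON THE HOFFMAN SUBGROUP: every element of value `0` of the
  subgroup of `KZ.FormalRep` generated by the Hoffman generators `[Δ_{|u|}, q'·ω_u]` (verbatim the
  target set of crux #6 `HoffmanSpanInKZ`, all weights together) lies in `KZ.relations`.  A SLICE OF
  THE SUMMIT (`hoffmanKernelInKZ_of_kzKernelConjecture`, `hoffmanKernelInKZ_of_kontsevichZagierPeriods`);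
  implied by the old crux #4 (`hoffmanKernelInKZ_of_mzvKernelInKZ`) and, given #6, EQUAL to it
  (`hoffmanKernelInKZ_iff_mzvKernelInKZ`).
* **HFI** (`HFormInd`) — FORMAL INDEPENDENCE: the formal combination `∑_u [Δ, l(u)·ω_u]` of the
  canonical Hoffman representations (Kontsevich's `KZ.mzvRep`, coefficient carried by `constMul`) is
  a relation only for `l = 0`.  No real number is evaluated in it; it follows from the crux by
  soundness and is what Brown's MOTIVIC independence (Ann. Math. 175 (2012), Thm 7.4) gives through any
  motivic realisation of the calculus killing the four move sets (Kontsevich–Zagier 2001 §4.1;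
  Huber–Müller-Stach 2017, Ch. 12–13): theorem-grade input, not a transcendence statement.

Main results (sorry-free, standard axioms):
* `hoffmanIndependence_iff_kernel_and_formal : HoffmanIndependence ↔ HK ∧ HFI` (EXACT split; glue
  `HoffmanIndependence_of_kernel_of_formal`, converses `hoffmanKernelInKZ_of_hoffmanIndependence`,
  `hoffmanFormalIndependence_of_hoffmanIndependence`);
* `hoffmanIndependence_of_formal_of_kontsevichZagierPeriods : HFI → KontsevichZagierPeriods →
  HoffmanIndependence` — MODULO THE THEOREM-GRADE HFI THE CRUX IS A SECTOR OF THE SUMMIT; all its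
  transcendence content sits in HK, which the summit contains;
* `closes_of_hoffmanKernelInKZ : DihedralNormalForm → HoffmanSpanInKZ → HK → ResidualBeyondGenusZero →
  KontsevichZagierPeriods` — the route's deciding theorem needs only HK in place of `HoffmanIndependence`,
  and then EVERY hypothesis is implied by the summit (`kontsevichZagierPeriods_iff_sector`: granted #6 and
  the value-level item `GenusZeroValuesMzv`, summit ↔ NF ∧ HK ∧ RES).
So the honest typing of the route's transcendence input is the residual sector HK (≤ summit), and
`HoffmanIndependence = HK ∧ HFI` exceeds it by the formal-independence statement only.
[cite: KontsevichZagier2001, §1.2 Conjecture 1] [cite: Brown2012, Theorem 1.1] [cite: Zagier1994, §9]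
-/

noncomputable section

namespace Summit.KontsevichZagierPeriods.LinRedNormalForm.HoffmanIndependence

open Set MeasureTheory
open Literature.NumberTheory.Transcendental MZV
open Summit.KontsevichZagierPeriods.KontsevichZagierPeriods.Theses.LinRedNormalForm
  (HoffmanIndependence HoffmanSpanInKZ MzvKernelInKZ DihedralNormalForm ResidualBeyondGenusZero
    GenusZeroValuesMzv)

/-! ## The two pieces, as local notations (written out in full in every landed signature) -/

-- the notations below contain binders / set-builder syntax, which the quotation pre-check cannot scan
set_option quotPrecheck false

/-- The Hoffman generator set, all weights together (verbatim the target set of crux #6). -/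
local notation "hGens" =>
  {x : KZ.FormalRep | ∃ (u : List ℕ) (q' : ℚ) (s' : KZ.IntegralRep (weight u)),
    IsHoffman u ∧
    s'.domain = {t | (∀ i, 0 < t i) ∧ (∀ i, t i < 1) ∧ StrictAnti t} ∧
    EqOn s'.integrand (fun t => (q' : ℝ) * KZ.mzvIntegrand u t) s'.domain ∧ x = KZ.of s'}

/-- HK: the KZ kernel conjecture on the Hoffman subgroup. -/
local notation "HKer" =>
  (∀ c ∈ AddSubgroup.closure hGens, KZ.eval c = 0 → c ∈ KZ.relations)

/-- The canonical representation `[Δ_{|u|}, q·ω_u]` (Kontsevich's simplex representation scaled by a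
rational constant; division by integers is not a rule, so the coefficient rides in the integrand). -/
local notation "canonR(" u ", " q ")" =>
  (KZ.IntegralRep.constMul ((q : ℚ) : ℝ) (isAlgebraic_algebraMap (q : ℚ))
    (KZ.mzvRep (Subtype.val u) (Subtype.property u).isAdmissible
      (KZ.mzvIntegrand_isSemialgebraicFunOn_holds (Subtype.val u))
      (KZ.mzvIntegrand_integrableOn_holds (Subtype.val u) (Subtype.property u).isAdmissible)))

/-- The formal combination `∑_u [Δ, l(u)·ω_u]`. -/
local notation "fComb(" l ")" =>
  (Finsupp.sum l fun (u : {u : List ℕ // IsHoffman u}) (q : ℚ) => KZ.of (canonR(u, q)))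

/-- HFI: formal independence of the canonical Hoffman representations modulo `KZ.relations`. -/
local notation "HFormInd" =>
  (∀ l : {u : List ℕ // IsHoffman u} →₀ ℚ, fComb(l) ∈ KZ.relations → l = 0)

/-! ## API of the canonical representations -/

/-- The integrand of the canonical representation, unfolded. [folklore] -/
theorem canon_integrand (u : {u : List ℕ // IsHoffman u}) (q : ℚ) (t : Fin (weight u.1) → ℝ) :
    (canonR(u, q)).integrand t = (q : ℝ) * KZ.mzvIntegrand u.1 t := rfl

/-- Kontsevich's formula for the canonical representation: value `q · ζ(u)`.
[cite: KontsevichZagier2001, §1.1] -/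
theorem canon_value (u : {u : List ℕ // IsHoffman u}) (q : ℚ) :
    (canonR(u, q)).value = (q : ℝ) * multipleZeta u.1 := by
  rw [KZ.IntegralRep.value_constMul, KZ.mzvRep_value_holds]

/-- The canonical representations are Hoffman generators. [folklore] -/
theorem of_canon_mem_hoffmanGensAll (u : {u : List ℕ // IsHoffman u}) (q : ℚ) :
    KZ.of (canonR(u, q)) ∈ hGens :=
  ⟨u.1, q, canonR(u, q), u.2, rfl, fun _ _ => rfl, rfl⟩

/-- Formal combinations of canonical representations lie in the Hoffman subgroup. [folklore] -/
theorem formalComb_mem_closure (l : {u : List ℕ // IsHoffman u} →₀ ℚ) :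
    fComb(l) ∈ AddSubgroup.closure hGens := by
  unfold Finsupp.sum
  exact AddSubgroup.sum_mem _ fun u _ => AddSubgroup.subset_closure (of_canon_mem_hoffmanGensAll u _)

/-- The value of a formal combination: `eval (∑_u [Δ, l(u)·ω_u]) = ∑_u l(u)·ζ(u)`.
[cite: KontsevichZagier2001, §1.1] -/
theorem eval_formalComb (l : {u : List ℕ // IsHoffman u} →₀ ℚ) :
    KZ.eval (fComb(l)) = l.sum fun u q => (q : ℝ) * multipleZeta u.1 := by
  rw [map_finsuppSum]
  exact Finsupp.sum_congr fun u _ => by rw [KZ.eval_of, canon_value]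

/-- A Hoffman generator is an MZV word generator (letters read off the binary word of the index):
the Hoffman generator set is contained in the generator set of crux `MzvKernelInKZ`. [folklore] -/
theorem hoffmanGensAll_subset_wordGens :
    hGens ⊆ {x : KZ.FormalRep | ∃ (w : ℕ) (ε : Fin w → Bool) (q : ℚ)
      (s : KZ.IntegralRep w), s.domain = {t | (∀ i, 0 < t i) ∧ (∀ i, t i < 1) ∧ StrictAnti t} ∧
      EqOn s.integrand (fun t => (q : ℝ) * ∏ i, if ε i then 1 / (1 - t i) else 1 / t i) s.domain ∧
      x = KZ.of s} := by
  rintro x ⟨u, q', s', -, hd, hi, rfl⟩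
  refine ⟨weight u, fun i => (binaryWord u).getD i false, q', s', hd, ?_, rfl⟩
  intro t ht
  rw [hi ht]
  rfl

/-! ## Soundness bookkeeping modulo `KZ.relations` (the normal form of the Hoffman subgroup) -/

/-- A representation whose integrand vanishes on its domain is a relation (integrand additivity
`f = f + f`). [cite: KontsevichZagier2001, §1.2 rule (1] -/
theorem of_mem_relations_of_integrand_zero {n : ℕ} (z : KZ.IntegralRep n)
    (hz : ∀ x ∈ z.domain, z.integrand x = 0) : KZ.of z ∈ KZ.relations := by
  have h3 : KZ.of z - KZ.of z - KZ.of z ∈ KZ.relations :=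
    KZ.integrandAddRel_subset_relations ⟨n, z, z, z, rfl, rfl, fun x hx => by simp [hz x hx], rfl⟩
  rw [show KZ.of z - KZ.of z - KZ.of z = -KZ.of z by abel] at h3
  exact neg_mem_iff.mp h3

/-- Two representations with the same domain whose integrands agree on it are congruent modulo the
relations (integrand additivity with the zero representation). [cite: KontsevichZagier2001, §1.2 rule (1] -/
theorem of_sub_of_mem_relations {n : ℕ} (r r' : KZ.IntegralRep n) (hd : r'.domain = r.domain)
    (h : EqOn r.integrand r'.integrand r.domain) : KZ.of r - KZ.of r' ∈ KZ.relations := by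
  let z : KZ.IntegralRep n := r.constMul 0 isAlgebraic_zero
  have hz : ∀ x ∈ z.domain, z.integrand x = 0 := fun x _ => by
    simp [z, KZ.IntegralRep.integrand_constMul]
  have h1 : KZ.of r - KZ.of r' - KZ.of z ∈ KZ.relations :=
    KZ.integrandAddRel_subset_relations
      ⟨n, r, r', z, hd, rfl, fun x hx => by simp [z, KZ.IntegralRep.integrand_constMul, h hx], rfl⟩
  have h2 := of_mem_relations_of_integrand_zero z hz
  rw [show KZ.of r - KZ.of r' = (KZ.of r - KZ.of r' - KZ.of z) + KZ.of z by abel]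
  exact add_mem h1 h2

/-- **Normal form of the Hoffman subgroup modulo relations.** Every element of the subgroup
generated by the Hoffman generators is congruent modulo `KZ.relations` to a formal combination
`∑_u [Δ, l(u)·ω_u]` of canonical representations: a generator `[Δ, f]` with `f = q'·ω_u` on `Δ` is
congruent to `[Δ, q'·ω_u]` by off-domain freedom, and the coefficient maps `q ↦ cls [Δ, q·ω_u]` are
additive by integrand additivity, so the classes assemble into an additive normal-form map on
`{u} →₀ ℚ`. [cite: KontsevichZagier2001, §1.2] -/
theorem exists_formalComb_congr {m : KZ.FormalRep} (hm : m ∈ AddSubgroup.closure hGens) :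
    ∃ l : {u : List ℕ // IsHoffman u} →₀ ℚ, m - fComb(l) ∈ KZ.relations := by
  let cls : KZ.FormalRep →+ KZ.FormalRep ⧸ KZ.relations := QuotientAddGroup.mk' _
  have cls_zero_iff : ∀ c, cls c = 0 ↔ c ∈ KZ.relations := fun c => QuotientAddGroup.eq_zero_iff c
  have cls_eq_iff : ∀ c c', cls c = cls c' ↔ c - c' ∈ KZ.relations := by
    intro c c'
    rw [← sub_eq_zero, ← map_sub, cls_zero_iff]
  let coef : (u : {u : List ℕ // IsHoffman u}) → ℚ →+ KZ.FormalRep ⧸ KZ.relations := fun u =>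
    { toFun := fun q => cls (KZ.of (canonR(u, q)))
      map_zero' := by
        rw [cls_zero_iff]
        exact of_mem_relations_of_integrand_zero _ fun t _ => by rw [canon_integrand]; simp
      map_add' := fun q₁ q₂ => by
        rw [← map_add, cls_eq_iff, ← sub_sub]
        exact KZ.integrandAddRel_subset_relations
          ⟨_, canonR(u, q₁ + q₂), canonR(u, q₁), canonR(u, q₂), rfl, rfl, fun t _ => by
            simp only [KZ.IntegralRep.integrand_constMul, Pi.add_apply, Rat.cast_add]; ring, rfl⟩ }
  have coef_apply : ∀ u q, coef u q = cls (KZ.of (canonR(u, q))) := fun u q => rfl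
  let nf : ({u : List ℕ // IsHoffman u} →₀ ℚ) →+ KZ.FormalRep ⧸ KZ.relations :=
    Finsupp.liftAddHom coef
  have nf_apply : ∀ l, nf l = l.sum fun u q => cls (KZ.of (canonR(u, q))) :=
    fun l => Finsupp.liftAddHom_apply _ _
  have nf_single : ∀ u q, nf (Finsupp.single u q) = cls (KZ.of (canonR(u, q))) :=
    fun u q => (Finsupp.liftAddHom_apply_single coef u q).trans (coef_apply u q)
  have cls_fComb : ∀ l, cls (fComb(l)) = nf l := fun l => by rw [map_finsuppSum, nf_apply]
  -- the normal form exists on the whole subgroup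
  have key : ∃ l, cls m = nf l := by
    induction hm using AddSubgroup.closure_induction with
    | mem x hx =>
      obtain ⟨u, q', s', hu, hd, hi, rfl⟩ := hx
      refine ⟨Finsupp.single ⟨u, hu⟩ q', ?_⟩
      rw [nf_single, cls_eq_iff]
      exact of_sub_of_mem_relations s' (canonR((⟨u, hu⟩ : {u : List ℕ // IsHoffman u}), q'))
        (by rw [hd]; rfl) fun t ht => by rw [canon_integrand]; exact hi ht
    | zero => exact ⟨0, by simp⟩
    | add x y _ _ ihx ihy =>
      obtain ⟨l₁, h₁⟩ := ihx
      obtain ⟨l₂, h₂⟩ := ihy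
      exact ⟨l₁ + l₂, by rw [map_add, map_add, h₁, h₂]⟩
    | neg x _ ih =>
      obtain ⟨l, h⟩ := ih
      exact ⟨-l, by rw [map_neg, map_neg, h]⟩
  obtain ⟨l, hl⟩ := key
  exact ⟨l, (cls_eq_iff _ _).1 (hl.trans (cls_fComb l).symm)⟩

/-! ## HK is a slice of the summit, and is the old crux #4 given #6 -/

/-- **`KZKernelConjecture → HK`**: the kernel conjecture restricted to the Hoffman subgroup.
[cite: KontsevichZagier2001, §1.2 Conjecture 1] -/
theorem hoffmanKernelInKZ_of_kzKernelConjecture (h : KZKernelConjecture) : HKer :=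
  fun c _ hc => h c hc

/-- **The summit implies HK** (`KontsevichZagierPeriods ↔ KZKernelConjecture`,
`kzKernelConjecture_iff_isRational` + `KontsevichZagierPeriods_iff`). [cite: KontsevichZagier2001, §1.2 Conjecture 1] -/
theorem hoffmanKernelInKZ_of_kontsevichZagierPeriods (h : _root_.KontsevichZagierPeriods) : HKer :=
  hoffmanKernelInKZ_of_kzKernelConjecture
    (kzKernelConjecture_iff_isRational.2 (_root_.KontsevichZagierPeriods_iff.1 h))

/-- **Crux #4 implies HK**: the Hoffman generators are MZV word generators. [folklore] -/
theorem hoffmanKernelInKZ_of_mzvKernelInKZ (h : MzvKernelInKZ) : HKer :=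
  fun c hc hc0 => h c (AddSubgroup.closure_mono hoffmanGensAll_subset_wordGens hc) hc0

/-- **Crux #6 and HK give crux #4** (the kernel on all MZV word representations): a vanishing
combination of word generators is congruent by #6 to an element of the Hoffman subgroup, still of
value `0` by soundness, hence a relation by HK. [cite: Brown2012, Theorem 1.1] [cite: KontsevichZagier2001, §1.2] -/
theorem mzvKernelInKZ_of_hoffmanSpanInKZ_of_hoffmanKernelInKZ (hSPAN : HoffmanSpanInKZ)
    (hK : HKer) : MzvKernelInKZ := by
  intro c hc hc0
  obtain ⟨m, hm, hcm⟩ := exists_mem_closure_sub_mem_of_forall KZ.relations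
    (T := hGens) (fun x hx => by
      obtain ⟨w, ε, q, s, hdom, hint, rfl⟩ := hx
      obtain ⟨m, hm, h⟩ := hSPAN w ε q s hdom hint
      refine ⟨m, AddSubgroup.closure_mono ?_ hm, h⟩
      rintro x ⟨u, q', s', hu, -, hd, hi, rfl⟩
      exact ⟨u, q', s', hu, hd, hi, rfl⟩) hc
  have hm0 : KZ.eval m = 0 := by
    have := (AddMonoidHom.mem_ker.1 (KZ.relations_le_ker_eval_holds hcm))
    rw [map_sub, hc0] at this
    linarith
  have key := add_mem hcm (hK m hm hm0)
  rwa [sub_add_cancel] at key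

/-- **Given crux #6, HK is exactly the old crux #4 `MzvKernelInKZ`.** [cite: Brown2012, Theorem 1.1] -/
theorem hoffmanKernelInKZ_iff_mzvKernelInKZ (hSPAN : HoffmanSpanInKZ) : HKer ↔ MzvKernelInKZ :=
  ⟨mzvKernelInKZ_of_hoffmanSpanInKZ_of_hoffmanKernelInKZ hSPAN, hoffmanKernelInKZ_of_mzvKernelInKZ⟩

/-! ## The exact split `HoffmanIndependence ↔ HK ∧ HFI` -/

/-- **The crux implies HFI** (soundness: a relation has value `0`, and the value of
`∑_u [Δ, l(u)·ω_u]` is `∑_u l(u)ζ(u)`). [cite: KontsevichZagier2001, §1.2] [cite: Brown2012, Theorem 7.4] -/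
theorem hoffmanFormalIndependence_of_hoffmanIndependence (h : HoffmanIndependence) : HFormInd := by
  intro l hl
  have h0 := (AddMonoidHom.mem_ker.1 (KZ.relations_le_ker_eval_holds hl))
  rw [eval_formalComb] at h0
  refine linearIndependent_iff.mp h l ?_
  rw [Finsupp.linearCombination_apply]
  simpa [Rat.smul_def] using h0

/-- **The crux implies HK**: an element of the Hoffman subgroup is congruent to a formal combination
`∑_u [Δ, l(u)·ω_u]` (`exists_formalComb_congr`); if its value vanishes, `∑ l(u)ζ(u) = 0`, so `l = 0`
by the crux and the element is a relation. [cite: Zagier1994, §9] [cite: KontsevichZagier2001, §1.2] -/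
theorem hoffmanKernelInKZ_of_hoffmanIndependence (h : HoffmanIndependence) : HKer := by
  intro c hc hc0
  obtain ⟨l, hl⟩ := exists_formalComb_congr hc
  have h0 : KZ.eval (fComb(l)) = 0 := by
    have := (AddMonoidHom.mem_ker.1 (KZ.relations_le_ker_eval_holds hl))
    rw [map_sub, hc0] at this
    linarith
  rw [eval_formalComb] at h0
  have hl0 : l = 0 := by
    refine linearIndependent_iff.mp h l ?_
    rw [Finsupp.linearCombination_apply]
    simpa [Rat.smul_def] using h0
  rw [hl0] at hl
  simpa using hl

/-- **The split glue: HK ∧ HFI ⟹ the crux.** A vanishing rational combination `∑ l(u)ζ(u) = 0` is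
the value of the formal combination `∑_u [Δ, l(u)·ω_u]`, an element of the Hoffman subgroup of value
`0`; HK makes it a relation and HFI forces `l = 0`. [cite: Zagier1994, §9] [cite: Brown2012, Theorem 7.4] -/
theorem HoffmanIndependence_of_kernel_of_formal : (∀ c ∈ AddSubgroup.closure {x : Literature.NumberTheory.Transcendental.KZ.FormalRep | ∃ (u : List ℕ) (q' : ℚ) (s' : Literature.NumberTheory.Transcendental.KZ.IntegralRep (Literature.NumberTheory.Transcendental.MZV.weight u)), Literature.NumberTheory.Transcendental.MZV.IsHoffman u ∧ s'.domain = {t | (∀ i, 0 < t i) ∧ (∀ i, t i < 1) ∧ StrictAnti t} ∧ Set.EqOn s'.integrand (fun t => (q' : ℝ) * Literature.NumberTheory.Transcendental.KZ.mzvIntegrand u t) s'.domain ∧ x = Literature.NumberTheory.Transcendental.KZ.of s'}, Literature.NumberTheory.Transcendental.KZ.eval c = 0 → c ∈ Literature.NumberTheory.Transcendental.KZ.relations) → (∀ l : {u : List ℕ // Literature.NumberTheory.Transcendental.MZV.IsHoffman u} →₀ ℚ, (l.sum fun u q => Literature.NumberTheory.Transcendental.KZ.of (Literature.NumberTheory.Transcendental.KZ.IntegralRep.constMul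 ((q : ℚ) : ℝ) (isAlgebraic_algebraMap (q : ℚ)) (Literature.NumberTheory.Transcendental.KZ.mzvRep u.1 u.2.isAdmissible (Literature.NumberTheory.Transcendental.KZ.mzvIntegrand_isSemialgebraicFunOn_holds u.1) (Literature.NumberTheory.Transcendental.KZ.mzvIntegrand_integrableOn_holds u.1 u.2.isAdmissible)))) ∈ Literature.NumberTheory.Transcendental.KZ.relations → l = 0) → HoffmanIndependence := by
  intro hK hF
  refine linearIndependent_iff.mpr fun l hl => hF l (hK _ (formalComb_mem_closure l) ?_)
  rw [eval_formalComb]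
  rw [Finsupp.linearCombination_apply] at hl
  simpa [Rat.smul_def] using hl

/-- **The sector split is exact**: `HoffmanIndependence ↔ HK ∧ HFI`. [cite: Zagier1994, §9] [cite: Brown2012, Theorem 7.4] -/
theorem hoffmanIndependence_iff_kernel_and_formal : HoffmanIndependence ↔ HKer ∧ HFormInd :=
  ⟨fun h => ⟨hoffmanKernelInKZ_of_hoffmanIndependence h,
    hoffmanFormalIndependence_of_hoffmanIndependence h⟩,
    fun h => HoffmanIndependence_of_kernel_of_formal h.1 h.2⟩

/-- Modulo formal independence, the crux IS the kernel conjecture on the Hoffman subgroup.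
[cite: Brown2012, Theorem 7.4] -/
theorem hoffmanIndependence_iff_hoffmanKernelInKZ (hF : HFormInd) : HoffmanIndependence ↔ HKer :=
  ⟨hoffmanKernelInKZ_of_hoffmanIndependence, fun hK => HoffmanIndependence_of_kernel_of_formal hK hF⟩

/-- **Modulo formal independence, the crux is a consequence (a sector) of the summit.**
[cite: KontsevichZagier2001, §1.2 Conjecture 1] [cite: Brown2012, Theorem 7.4] -/
theorem hoffmanIndependence_of_formal_of_kontsevichZagierPeriods (hF : HFormInd)
    (hS : _root_.KontsevichZagierPeriods) : HoffmanIndependence :=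
  HoffmanIndependence_of_kernel_of_formal (hoffmanKernelInKZ_of_kontsevichZagierPeriods hS) hF

/-- Modulo formal independence, the old crux #4 already gives the crux (no spanning needed).
[cite: Brown2012, Theorem 7.4] -/
theorem hoffmanIndependence_of_formal_of_mzvKernelInKZ (hF : HFormInd) (h : MzvKernelInKZ) :
    HoffmanIndependence :=
  HoffmanIndependence_of_kernel_of_formal (hoffmanKernelInKZ_of_mzvKernelInKZ h) hF

/-! ## The route needs only HK: a deciding theorem with every hypothesis below the summit -/

/-- **Deciding theorem of route LinRedNormalForm with HK in place of `HoffmanIndependence`.**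
`DihedralNormalForm → HoffmanSpanInKZ → HK → ResidualBeyondGenusZero → KontsevichZagierPeriods`:
#6 and HK give the kernel on MZV word representations, and the landed `assembly_proof` concludes.
[cite: KontsevichZagier2001, §1.2 Conjecture 1] [cite: Brown2012, Theorem 1.1] -/
theorem closes_of_hoffmanKernelInKZ (hNF : DihedralNormalForm) (hSPAN : HoffmanSpanInKZ) (hK : HKer)
    (hRES : ResidualBeyondGenusZero) : _root_.KontsevichZagierPeriods := by
  have hA : DihedralNormalForm → MzvKernelInKZ → ResidualBeyondGenusZero →
      _root_.KontsevichZagierPeriods := assembly_proof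
  exact hA hNF (mzvKernelInKZ_of_hoffmanSpanInKZ_of_hoffmanKernelInKZ hSPAN hK) hRES

/-- The declared residual is implied by the summit (take `c₀ = 0`; cf.
`ResidualBeyondGenusZero.residualBeyondGenusZero_of_kontsevichZagierPeriods`). [cite: KontsevichZagier2001, §1.2 Conjecture 1] -/
theorem residualBeyondGenusZero_of_summit (h : _root_.KontsevichZagierPeriods) :
    ResidualBeyondGenusZero := by
  intro c hc
  refine ⟨0, zero_mem _, ?_⟩
  rw [sub_zero]
  exact kzKernelConjecture_iff_isRational.2 (_root_.KontsevichZagierPeriods_iff.1 h) c hc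

/-- The genus-zero normal form is implied by the summit modulo the value-level form of Brown's
theorem on periods of `M_{0,n}` (item `GenusZeroValuesMzv`): the combination of word representations
with the right value differs from `[r]` by an element of `ker eval = relations`.
[cite: BrownENS2009, Theorem 1.1] [cite: KontsevichZagier2001, §1.2 Conjecture 1] -/
theorem dihedralNormalForm_of_values_of_summit (hV : GenusZeroValuesMzv)
    (h : _root_.KontsevichZagierPeriods) : DihedralNormalForm := by
  intro k r p a b c hdom hint
  obtain ⟨m, hm, hmv⟩ := hV k r p a b c hdom hint
  refine ⟨m, hm, ?_⟩
  refine kzKernelConjecture_iff_isRational.2 (_root_.KontsevichZagierPeriods_iff.1 h) _ ?_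
  rw [map_sub, KZ.eval_of, hmv, sub_self]

/-- **Granted crux #6 and the value-level theorem `GenusZeroValuesMzv`, the summit is EXACTLY the
conjunction of the route's genus-zero normal form, the kernel on the Hoffman subgroup and the
declared residual**: `KontsevichZagierPeriods ↔ DihedralNormalForm ∧ HK ∧ ResidualBeyondGenusZero`.
(⇒) each conjunct is a consequence of the summit; (⇐) `closes_of_hoffmanKernelInKZ`. This is the
conjunct accounting of route LinRedNormalForm: attacked conjuncts `DihedralNormalForm` (with
`ArrangementNormalForm` beneath it) and `HoffmanSpanInKZ`; residual conjuncts HK (transcendence) and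
`ResidualBeyondGenusZero` (the other sectors). [cite: KontsevichZagier2001, §1.2 Conjecture 1] [cite: BrownENS2009, Theorem 1.1] -/
theorem kontsevichZagierPeriods_iff_sector (hV : GenusZeroValuesMzv) (hSPAN : HoffmanSpanInKZ) :
    _root_.KontsevichZagierPeriods ↔ DihedralNormalForm ∧ HKer ∧ ResidualBeyondGenusZero :=
  ⟨fun h => ⟨dihedralNormalForm_of_values_of_summit hV h, hoffmanKernelInKZ_of_kontsevichZagierPeriods h,
      residualBeyondGenusZero_of_summit h⟩,
    fun h => closes_of_hoffmanKernelInKZ h.1 hSPAN h.2.1 h.2.2⟩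

end Summit.KontsevichZagierPeriods.LinRedNormalForm.HoffmanIndependence
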